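import Literature.NumberTheory.Transcendental.HermiteIntegerPointsRatio
import Literature.NumberTheory.Transcendental.HermiteInterpolationBoundTaylor
import HarnessLib

/-!
# Hermite extrapolation at integer points with a free radius ratio — TAYLOR-NORMALISED jets

Support file (theorems only; no definitions, no named facts), sequel to `HermiteIntegerPointsRatio.lean` (cell
`abc-stewartyu`, HOME `run/shared/lean/pub/abc-stewartyu/`, archimedean Gen-3 frame WP-L.A, parcel P-A5).  The three
node-set estimates of that file (`CW77.hermite_integer_points_ratio`, `…_symm_…`, `hermite_odd_points_ratio`) take the
jets in the form `|f^{(σ)}(x)| ≤ ε`; Nesterenko's k-step (LNM 1819 (2003), §4.1 (4.9), §4.2 Lemma 4.3 (4.19)) bounds the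
TAYLOR COEFFICIENTS `(1/t!) f^{(t)}(x)` instead, which is what keeps the cost per derivative at `log(eBN) + O(1)`
((4.20)–(4.23)) rather than a height.  By `Hermite.norm_le_of_small_taylor_jets` the hypothesis `|f^{(σ)}(x)| ≤ σ!·ε`
gives the IDENTICAL conclusions:

* `hermite_integer_points_ratio_taylor` — nodes `0, …, k−1`, `|w| ≤ 2k`, `|f| ≤ B_f` on `|z| = (3E+1)k`;
* `hermite_symm_integer_points_ratio_taylor` — symmetric nodes `|j| ≤ m` (Nesterenko's `𝒳_{0,0}`, `𝒳_{s,ν≥1}`);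
* `hermite_odd_points_ratio_taylor` — odd nodes `|x| ≤ 2m − 1` (Nesterenko's `𝒳_{s,0}`).

The proofs are those of the un-normalised file with the one lemma swapped.  WHAT THIS IS NOT: not a step of any frame.

## References

* [Nesterenko2003] Yu. V. Nesterenko, *Linear forms in logarithms of rational numbers*, LNM 1819 (2003), 53–106 —
  §4.1 (4.8)–(4.11), Lemma 4.2 (p. 81–83); §4.2 Lemma 4.3 (4.18)–(4.23) (p. 84–87), (4.24)–(4.30) (p. 87–88).
* [CijsouwWaldschmidt1977] P. L. Cijsouw, M. Waldschmidt, Compositio Math. 34 (1977) — Lemma 2 (the model).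
-/

noncomputable section

open Finset Real

namespace Literature.NumberTheory.Transcendental.CW77

/-- **Hermite extrapolation at the integer points `0, …, k−1` with a free radius ratio and TAYLOR-NORMALISED jets.**
If `f` is entire, `|f^{(σ)}(i)| ≤ σ!·ε` for all integers `0 ≤ i < k` and `σ < t` (`k, t ≥ 1`), `E ≥ 1`, and
`|f| ≤ B_f` on the circle `|z| = (3E+1)k`, then for `|w| ≤ 2k`,
`|f(w)| ≤ 2 k^{t+1} t (20e)^{kt} ε + B_f · (1/E)^{kt}` — the SAME conclusion as `hermite_integer_points_ratio`
(via `Hermite.norm_le_of_small_taylor_jets`).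
[cite: Nesterenko2003, §4.1 (4.8)–(4.11), Lemma 4.2, p. 81–83; §4.2 Lemma 4.3 (4.19), (4.29)] -/
theorem hermite_integer_points_ratio_taylor {f : ℂ → ℂ} (hf : Differentiable ℂ f) {k t : ℕ} (hk : 1 ≤ k)
    (ht : 1 ≤ t) {ε Bf E : ℝ} (hε : 0 ≤ ε) (hE : 1 ≤ E)
    (hsmall : ∀ i : ℕ, i < k → ∀ σ, σ < t → ‖iteratedDeriv σ f (i : ℂ)‖ ≤ σ.factorial * ε)
    (hB : ∀ z ∈ Metric.sphere (0 : ℂ) ((3 * E + 1) * k), ‖f z‖ ≤ Bf) {w : ℂ} (hw : ‖w‖ ≤ 2 * k) :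
    ‖f w‖ ≤ 2 * (k : ℝ) ^ (t + 1) * t * (20 * Real.exp 1) ^ (k * t) * ε + Bf * (1 / E) ^ (k * t) := by
  classical
  set Es : Finset ℂ := (range k).image (fun j : ℕ => (j : ℂ)) with hEs
  have hinj : Function.Injective (fun j : ℕ => (j : ℂ)) := Nat.cast_injective
  have hcard : Es.card = k := by rw [hEs, card_image_of_injective _ hinj, card_range]
  set Λ₀ : ℝ := (k - 1).factorial / 2 ^ (k - 1) with hΛ₀
  have hΛ₀pos : 0 < Λ₀ := by rw [hΛ₀]; positivity
  have hk1 : (1 : ℝ) ≤ k := by exact_mod_cast hk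
  have hk0 : (0 : ℝ) < k := by linarith
  have hE0 : (0 : ℝ) < E := by linarith
  -- hypotheses of the Hermite estimate
  have hEr : ∀ e ∈ Es, ‖e‖ ≤ (k : ℝ) := by
    intro e he
    obtain ⟨j, hj, rfl⟩ := mem_image.mp he
    rw [Complex.norm_natCast]
    exact_mod_cast (mem_range.mp hj).le
  have hsep : ∀ e₁ ∈ Es, ∀ e₂ ∈ Es, e₁ ≠ e₂ → (1 : ℝ) ≤ ‖e₁ - e₂‖ := by
    intro e₁ he₁ e₂ he₂ hne
    obtain ⟨j₁, _, rfl⟩ := mem_image.mp he₁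
    obtain ⟨j₂, _, rfl⟩ := mem_image.mp he₂
    have hne' : j₁ ≠ j₂ := fun h => hne (by rw [h])
    rw [← Complex.ofReal_natCast, ← Complex.ofReal_natCast, ← Complex.ofReal_sub, Complex.norm_real,
      Real.norm_eq_abs, ← Int.cast_natCast, ← Int.cast_natCast (R := ℝ) j₂, ← Int.cast_sub,
      ← Int.cast_abs]
    have : (1 : ℤ) ≤ |(j₁ : ℤ) - j₂| := Int.one_le_abs (sub_ne_zero.mpr (by exact_mod_cast hne'))
    exact_mod_cast this
  have hprod : ∀ e ∈ Es, Λ₀ ≤ ∏ e' ∈ Es.erase e, ‖e - e'‖ := by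
    intro e he
    obtain ⟨i, hi, rfl⟩ := mem_image.mp he
    have hi' := mem_range.mp hi
    rw [hEs, prod_norm_sub_natCast hi', hΛ₀, div_le_iff₀ (by positivity)]
    have := factorial_le_two_pow_mul (show i ≤ k - 1 by omega)
    have hki : k - 1 - i = (k - 1) - i := rfl
    calc ((k - 1).factorial : ℝ) ≤ 2 ^ (k - 1) * (i.factorial * ((k - 1) - i).factorial) := this
      _ = (i.factorial : ℝ) * (k - 1 - i).factorial * 2 ^ (k - 1) := by ring
  have hsmall' : ∀ e ∈ Es, ∀ σ < t, ‖iteratedDeriv σ f e‖ ≤ σ.factorial * ε := by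
    intro e he σ hσ
    obtain ⟨i, hi, rfl⟩ := mem_image.mp he
    exact hsmall i (mem_range.mp hi) σ hσ
  have hρR : 2 * (k : ℝ) ≤ (3 * E + 1) * k := by nlinarith
  have hrR : (k : ℝ) < (3 * E + 1) * k := by nlinarith
  have key := Hermite.norm_le_of_small_taylor_jets hf Es t (r := k) (R := (3 * E + 1) * k) (ρ := 2 * k)
    (δ := 1) hk1 (by positivity) hρR hrR one_pos le_rfl hΛ₀pos hε hEr hsep hprod hsmall' hB hw
  rw [hcard] at key
  -- simplify the two terms
  have h2δ : ((2 : ℝ) / 1) ^ t = 2 ^ t := by rw [div_one]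
  rw [h2δ] at key
  have hratio : ((2 * (k : ℝ) + k) / ((3 * E + 1) * k - k)) = 1 / E := by
    field_simp; ring
  rw [hratio] at key
  -- the factor `(2ck)^{tk} 2^t / Λ₀^t ≤ k^t (4ce)^{kt}`
  have hfac : ∀ c : ℝ, 0 ≤ c →
      (2 * (c * k)) ^ (t * k) * 2 ^ t / Λ₀ ^ t ≤ (k : ℝ) ^ t * (4 * c * Real.exp 1) ^ (k * t) := by
    intro c hc
    rw [hΛ₀, div_pow, div_div_eq_mul_div, ← pow_mul, div_le_iff₀ (by positivity)]
    have hk' : ((k - 1).factorial : ℝ) * k = k.factorial := by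
      rw [mul_comm]; exact_mod_cast Nat.mul_factorial_pred (by omega)
    have hunit : (2 * (c * k)) ^ k * 2 * 2 ^ (k - 1) ≤
        (k : ℝ) * (4 * c * Real.exp 1) ^ k * (k - 1).factorial := by
      have h22 : (2 * (c * (k : ℝ))) ^ k * 2 * 2 ^ (k - 1) = (4 * c) ^ k * (k : ℝ) ^ k := by
        have : (2 : ℝ) * 2 ^ (k - 1) = 2 ^ k := by
          rw [← pow_succ']; congr 1; omega
        calc (2 * (c * (k : ℝ))) ^ k * 2 * 2 ^ (k - 1) = (2 * (c * k)) ^ k * (2 * 2 ^ (k - 1)) := by ring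
          _ = (2 * (c * k)) ^ k * 2 ^ k := by rw [this]
          _ = (2 * (c * k) * 2) ^ k := by rw [← mul_pow]
          _ = (4 * c * k) ^ k := by ring_nf
          _ = (4 * c) ^ k * (k : ℝ) ^ k := by rw [← mul_pow]
      rw [h22]
      have hkk := pow_self_le_exp_mul_factorial k
      calc (4 * c) ^ k * (k : ℝ) ^ k ≤ (4 * c) ^ k * (Real.exp 1 ^ k * k.factorial) :=
            mul_le_mul_of_nonneg_left hkk (by positivity)
        _ = (4 * c * Real.exp 1) ^ k * (((k - 1).factorial : ℝ) * k) := by rw [hk', mul_pow]; ring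
        _ = (k : ℝ) * (4 * c * Real.exp 1) ^ k * (k - 1).factorial := by ring
    rw [pow_mul (2 : ℝ) (k - 1) t, mul_comm t k, pow_mul (2 * (c * (k : ℝ))) k t, ← mul_pow, ← mul_pow]
    calc ((2 * (c * ↑k)) ^ k * 2 * 2 ^ (k - 1)) ^ t
        ≤ ((k : ℝ) * (4 * c * Real.exp 1) ^ k * (k - 1).factorial) ^ t :=
          pow_le_pow_left₀ (by positivity) hunit t
      _ = (k : ℝ) ^ t * (4 * c * Real.exp 1) ^ (k * t) * ((k - 1).factorial : ℝ) ^ t := by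
          rw [mul_pow, mul_pow, ← pow_mul]
  have hA := hfac 3 (by norm_num)                 -- ρ + r = 3k
  have hBt := hfac (3 * E + 2) (by positivity)    -- R + r = (3E+2)k
  have e1 : (2 * (2 * (k : ℝ) + k)) = 2 * (3 * k) := by ring
  have e2 : (2 * ((3 * E + 1) * (k : ℝ) + k)) = 2 * ((3 * E + 2) * k) := by ring
  rw [e1, e2] at key
  have hEpow : (0 : ℝ) ≤ (1 / E) ^ (t * k) := by positivity
  have hBf0 : 0 ≤ Bf := by
    have h0 : (0 : ℝ) ≤ (3 * E + 1) * k := by positivity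
    have hz : ((((3 * E + 1) * k : ℝ)) : ℂ) ∈ Metric.sphere (0 : ℂ) ((3 * E + 1) * k) := by
      rw [Metric.mem_sphere, dist_zero_right, Complex.norm_real, Real.norm_eq_abs, abs_of_nonneg h0]
    exact (norm_nonneg _).trans (hB _ hz)
  -- first term
  have T1 : (k : ℝ) * t * ε * (2 * (3 * k)) ^ (t * k) * 2 ^ t / Λ₀ ^ t ≤
      (k : ℝ) ^ (t + 1) * t * (20 * Real.exp 1) ^ (k * t) * ε := by
    have : (k : ℝ) * t * ε * (2 * (3 * k)) ^ (t * k) * 2 ^ t / Λ₀ ^ t =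
        (k * t * ε) * ((2 * (3 * k)) ^ (t * k) * 2 ^ t / Λ₀ ^ t) := by ring
    rw [this]
    have h12 : (k : ℝ) ^ t * (4 * 3 * Real.exp 1) ^ (k * t) ≤
        (k : ℝ) ^ t * (20 * Real.exp 1) ^ (k * t) := by
      apply mul_le_mul_of_nonneg_left _ (by positivity)
      apply pow_le_pow_left₀ (by positivity)
      nlinarith [Real.exp_pos 1]
    calc (k * t * ε) * ((2 * (3 * (k : ℝ))) ^ (t * k) * 2 ^ t / Λ₀ ^ t)
        ≤ (k * t * ε) * ((k : ℝ) ^ t * (20 * Real.exp 1) ^ (k * t)) :=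
          mul_le_mul_of_nonneg_left (hA.trans h12) (by positivity)
      _ = (k : ℝ) ^ (t + 1) * t * (20 * Real.exp 1) ^ (k * t) * ε := by ring
  -- second term: `(2(3E+2)k)^{tk} 2^t/Λ₀^t · (1/E)^{tk} ≤ k^t (4(3E+2)e/E)^{kt} ≤ k^t (20e)^{kt}`
  have T2 : (Bf + (k : ℝ) * t * ε * (2 * ((3 * E + 2) * k)) ^ (t * k) * 2 ^ t / Λ₀ ^ t) *
        (1 / E) ^ (t * k) ≤
      Bf * (1 / E) ^ (k * t) + (k : ℝ) ^ (t + 1) * t * (20 * Real.exp 1) ^ (k * t) * ε := by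
    have hsecond : (k : ℝ) * t * ε * (2 * ((3 * E + 2) * k)) ^ (t * k) * 2 ^ t / Λ₀ ^ t *
          (1 / E) ^ (t * k) ≤
        (k : ℝ) ^ (t + 1) * t * (20 * Real.exp 1) ^ (k * t) * ε := by
      have e : (k : ℝ) * t * ε * (2 * ((3 * E + 2) * k)) ^ (t * k) * 2 ^ t / Λ₀ ^ t *
            (1 / E) ^ (t * k) =
          (k * t * ε) * (((2 * ((3 * E + 2) * k)) ^ (t * k) * 2 ^ t / Λ₀ ^ t) * (1 / E) ^ (t * k)) := by
        ring
      rw [e]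
      have h1 : ((2 * ((3 * E + 2) * (k : ℝ))) ^ (t * k) * 2 ^ t / Λ₀ ^ t) * (1 / E) ^ (t * k) ≤
          ((k : ℝ) ^ t * (4 * (3 * E + 2) * Real.exp 1) ^ (k * t)) * (1 / E) ^ (t * k) :=
        mul_le_mul_of_nonneg_right hBt hEpow
      have hcE : 4 * (3 * E + 2) * Real.exp 1 * (1 / E) ≤ 20 * Real.exp 1 := by
        have h8 : 8 / E ≤ 8 := div_le_self (by norm_num) hE
        have heq : 4 * (3 * E + 2) * Real.exp 1 * (1 / E) = (12 + 8 / E) * Real.exp 1 := by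
          field_simp
          ring
        rw [heq]
        nlinarith [Real.exp_pos 1]
      have h2 : ((k : ℝ) ^ t * (4 * (3 * E + 2) * Real.exp 1) ^ (k * t)) * (1 / E) ^ (t * k) ≤
          (k : ℝ) ^ t * (20 * Real.exp 1) ^ (k * t) := by
        rw [mul_comm t k, mul_assoc, ← mul_pow]
        apply mul_le_mul_of_nonneg_left _ (by positivity)
        exact pow_le_pow_left₀ (by positivity) hcE _
      calc (k * t * ε) * (((2 * ((3 * E + 2) * (k : ℝ))) ^ (t * k) * 2 ^ t / Λ₀ ^ t) * (1 / E) ^ (t * k))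
          ≤ (k * t * ε) * ((k : ℝ) ^ t * (20 * Real.exp 1) ^ (k * t)) :=
            mul_le_mul_of_nonneg_left (h1.trans h2) (by positivity)
        _ = (k : ℝ) ^ (t + 1) * t * (20 * Real.exp 1) ^ (k * t) * ε := by ring
    calc (Bf + (k : ℝ) * t * ε * (2 * ((3 * E + 2) * k)) ^ (t * k) * 2 ^ t / Λ₀ ^ t) * (1 / E) ^ (t * k)
        = Bf * (1 / E) ^ (t * k) +
            (k : ℝ) * t * ε * (2 * ((3 * E + 2) * k)) ^ (t * k) * 2 ^ t / Λ₀ ^ t * (1 / E) ^ (t * k) := by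
          ring
      _ ≤ Bf * (1 / E) ^ (t * k) + (k : ℝ) ^ (t + 1) * t * (20 * Real.exp 1) ^ (k * t) * ε :=
          add_le_add le_rfl hsecond
      _ = Bf * (1 / E) ^ (k * t) + (k : ℝ) ^ (t + 1) * t * (20 * Real.exp 1) ^ (k * t) * ε := by
          rw [mul_comm k t]
  linarith [key, T1, T2]

/-- **The same at the symmetric integer nodes `j ∈ ℤ, |j| ≤ m`, Taylor-normalised jets** (`k = 2m+1` nodes;
Nesterenko's sets `𝒳_{0,0}` and `𝒳_{s,ν}`, `ν ≥ 1`): if `|f^{(σ)}(j)| ≤ σ!·ε` for `|j| ≤ m`, `σ < t`, and `|f| ≤ B_f`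
on the disc `|z| ≤ (3E+1)(2m+1) + m`, then for `|w| ≤ 3m+2`,
`|f(w)| ≤ 2 (2m+1)^{t+1} t (20e)^{(2m+1)t} ε + B_f (1/E)^{(2m+1)t}` (translate `z ↦ z − m`).
[cite: Nesterenko2003, §4.1 Lemma 4.2, §4.2 (4.19), (4.24)–(4.29) (the sets 𝒳_{s,ν}), p. 82–88] -/
theorem hermite_symm_integer_points_ratio_taylor {f : ℂ → ℂ} (hf : Differentiable ℂ f) (m : ℕ) {t : ℕ}
    (ht : 1 ≤ t) {ε Bf E : ℝ} (hε : 0 ≤ ε) (hE : 1 ≤ E)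
    (hsmall : ∀ j : ℤ, |j| ≤ m → ∀ σ, σ < t → ‖iteratedDeriv σ f (j : ℂ)‖ ≤ σ.factorial * ε)
    (hB : ∀ z : ℂ, ‖z‖ ≤ (3 * E + 1) * (2 * m + 1) + m → ‖f z‖ ≤ Bf)
    {w : ℂ} (hw : ‖w‖ ≤ 3 * m + 2) :
    ‖f w‖ ≤ 2 * ((2 * m + 1 : ℕ) : ℝ) ^ (t + 1) * t * (20 * Real.exp 1) ^ ((2 * m + 1) * t) * ε +
      Bf * (1 / E) ^ ((2 * m + 1) * t) := by
  set k : ℕ := 2 * m + 1 with hk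
  have hk1 : 1 ≤ k := by omega
  set g : ℂ → ℂ := fun z => f (z - m) with hg
  have hgd : Differentiable ℂ g := hf.comp (differentiable_id.sub_const _)
  have hg_deriv : ∀ σ (z : ℂ), iteratedDeriv σ g z = iteratedDeriv σ f (z - m) := by
    intro σ z
    rw [hg, iteratedDeriv_comp_sub_const]
  have hg_small : ∀ i : ℕ, i < k → ∀ σ, σ < t → ‖iteratedDeriv σ g (i : ℂ)‖ ≤ σ.factorial * ε := by
    intro i hi σ hσ
    rw [hg_deriv]
    have hj : |((i : ℤ) - m)| ≤ (m : ℤ) := by rw [abs_le]; constructor <;> omega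
    have h := hsmall ((i : ℤ) - m) hj σ hσ
    have hcast : (((i : ℤ) - m : ℤ) : ℂ) = (i : ℂ) - (m : ℂ) := by push_cast; ring
    rwa [hcast] at h
  have hg_B : ∀ z ∈ Metric.sphere (0 : ℂ) ((3 * E + 1) * k), ‖g z‖ ≤ Bf := by
    intro z hz
    have hzR : ‖z‖ = (3 * E + 1) * k := by simpa using hz
    apply hB
    calc ‖z - (m : ℂ)‖ ≤ ‖z‖ + ‖(m : ℂ)‖ := norm_sub_le _ _
      _ = (3 * E + 1) * (2 * m + 1) + m := by rw [hzR, Complex.norm_natCast, hk]; push_cast; ring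
  have hw' : ‖w + m‖ ≤ 2 * (k : ℝ) := by
    calc ‖w + (m : ℂ)‖ ≤ ‖w‖ + ‖(m : ℂ)‖ := norm_add_le _ _
      _ ≤ 3 * m + 2 + m := by rw [Complex.norm_natCast]; linarith
      _ = 2 * (k : ℝ) := by rw [hk]; push_cast; ring
  have key := hermite_integer_points_ratio_taylor hgd hk1 ht hε hE hg_small hg_B hw'
  have hgw : g (w + m) = f w := by simp [hg]
  rw [hgw] at key
  exact key

/-- **The same at the odd nodes `x ≡ 1 (mod 2)`, `|x| ≤ 2m − 1`, Taylor-normalised jets** (`k = 2m` nodes, `m ≥ 1`;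
Nesterenko's sets `𝒳_{s,0}`, `s ≥ 1`): if `|f^{(σ)}(x)| ≤ σ!·ε` for odd `|x| ≤ 2m−1`, `σ < t`, and
`|f| ≤ B_f` on the disc `|z| ≤ (12E+6)m`, then for `|w| ≤ 6m`,
`|f(w)| ≤ 2 (2m)^{t+1} t (20e)^{2mt} (2^t ε) + B_f (1/E)^{2mt}` (`g(z) = f(2z − (2m−1))` has jets
`2^σ f^{(σ)}`, and `2^σ σ! ε ≤ σ!·(2^t ε)`). [cite: Nesterenko2003, §4.1 Lemma 4.2, §4.2 (4.19) (the sets 𝒳_{s,0}), §4.3 (4.36), p. 82–90] -/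
theorem hermite_odd_points_ratio_taylor {f : ℂ → ℂ} (hf : Differentiable ℂ f) {m t : ℕ} (hm : 1 ≤ m)
    (ht : 1 ≤ t) {ε Bf E : ℝ} (hε : 0 ≤ ε) (hE : 1 ≤ E)
    (hsmall : ∀ x : ℤ, Odd x → |x| ≤ 2 * m - 1 → ∀ σ, σ < t → ‖iteratedDeriv σ f (x : ℂ)‖ ≤ σ.factorial * ε)
    (hB : ∀ z : ℂ, ‖z‖ ≤ (12 * E + 6) * m → ‖f z‖ ≤ Bf)
    {w : ℂ} (hw : ‖w‖ ≤ 6 * m) :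
    ‖f w‖ ≤ 2 * ((2 * m : ℕ) : ℝ) ^ (t + 1) * t * (20 * Real.exp 1) ^ ((2 * m) * t) * (2 ^ t * ε) +
      Bf * (1 / E) ^ ((2 * m) * t) := by
  set k : ℕ := 2 * m with hk
  have hk1 : 1 ≤ k := by omega
  have hE0 : 0 < E := by linarith
  have hm1 : (1 : ℝ) ≤ m := by exact_mod_cast hm
  set c : ℂ := (2 * (m : ℂ) - 1) with hc
  have hc_norm : ‖c‖ ≤ 2 * m := by
    have : c = ((2 * (m : ℝ) - 1 : ℝ) : ℂ) := by rw [hc]; push_cast; ring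
    rw [this, Complex.norm_real, Real.norm_eq_abs, abs_le]
    constructor <;> linarith
  set g : ℂ → ℂ := fun z => f (2 * z - c) with hg
  have hgd : Differentiable ℂ g := hf.comp (by fun_prop)
  have hg_eq : g = fun z => (fun y => f (2 * y)) (z - c / 2) := by
    funext z; simp only [hg]; congr 1; ring
  have hg_deriv : ∀ σ (z : ℂ), iteratedDeriv σ g z = 2 ^ σ * iteratedDeriv σ f (2 * z - c) := by
    intro σ z
    rw [hg_eq, iteratedDeriv_comp_sub_const σ (fun y => f (2 * y)) (c / 2)]
    simp only
    rw [iteratedDeriv_comp_const_mul (hf.contDiff) (2 : ℂ)]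
    simp only
    congr 2; ring
  have hg_small : ∀ i : ℕ, i < k → ∀ σ, σ < t → ‖iteratedDeriv σ g (i : ℂ)‖ ≤ σ.factorial * (2 ^ t * ε) := by
    intro i hi σ hσ
    rw [hg_deriv, norm_mul, norm_pow, Complex.norm_ofNat]
    have hodd : Odd (2 * (i : ℤ) - (2 * m - 1)) := ⟨(i : ℤ) - m, by ring⟩
    have habs : |2 * (i : ℤ) - (2 * m - 1)| ≤ 2 * (m : ℕ) - 1 := by
      rw [abs_le]; constructor <;> omega
    have h := hsmall _ hodd habs σ hσ
    have hcast : ((2 * (i : ℤ) - (2 * m - 1) : ℤ) : ℂ) = 2 * (i : ℂ) - c := by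
      rw [hc]; push_cast; ring
    rw [hcast] at h
    have h2 : (2 : ℝ) ^ σ ≤ 2 ^ t := pow_le_pow_right₀ one_le_two hσ.le
    calc (2 : ℝ) ^ σ * ‖iteratedDeriv σ f (2 * (i : ℂ) - c)‖ ≤ 2 ^ t * (σ.factorial * ε) :=
          mul_le_mul h2 h (norm_nonneg _) (by positivity)
      _ = σ.factorial * (2 ^ t * ε) := by ring
  have hg_B : ∀ z ∈ Metric.sphere (0 : ℂ) ((3 * E + 1) * k), ‖g z‖ ≤ Bf := by
    intro z hz
    have hzR : ‖z‖ = (3 * E + 1) * k := by simpa using hz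
    apply hB
    calc ‖2 * z - c‖ ≤ ‖2 * z‖ + ‖c‖ := norm_sub_le _ _
      _ ≤ 2 * ((3 * E + 1) * k) + 2 * m := by
          rw [norm_mul, Complex.norm_ofNat, hzR]; linarith
      _ = (12 * E + 6) * m := by rw [hk]; push_cast; ring
  have hw' : ‖(w + c) / 2‖ ≤ 2 * (k : ℝ) := by
    rw [norm_div, Complex.norm_ofNat, div_le_iff₀ (by norm_num : (0 : ℝ) < 2)]
    calc ‖w + c‖ ≤ ‖w‖ + ‖c‖ := norm_add_le _ _
      _ ≤ 6 * m + 2 * m := by linarith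
      _ = 2 * (k : ℝ) * 2 := by rw [hk]; push_cast; ring
  have key := hermite_integer_points_ratio_taylor hgd hk1 ht (by positivity) hE hg_small hg_B hw'
  have hgw : g ((w + c) / 2) = f w := by
    simp only [hg]; congr 1; ring
  rw [hgw] at key
  exact key

end Literature.NumberTheory.Transcendental.CW77

end
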